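import Literature.Analysis.FluidPDE.TypeIAncientMild
import HarnessLib

/-!
# LINE g7-δ — T1 GUARD (typed sub-targets for the prover of `stub_coherentSelection`; workfile, NOT a skeleton, no registry act)

The census (kit j316185) and core-cut mining (kit j316214) showed PASSIVE super-efficient cells: weak vorticity sitting in the
strain of a neighbouring core has cell efficiency `e_Q = |J_Q| / (M √(Z_Q P_Q))` several times the field's, with vanishing own
budget — a naive «max e_Q» selection would pick such cells and the zoom limit would be trivial.  The guard below excludes them
WITHOUT cutting fields and WITHOUT Biot–Savart of non-decaying vorticity:

* `StrainSplitBound` (G0, the analytic input, M–L): for a bounded `C³` divergence-free field, the strain quadratic form at `x`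
  is bounded by `C · (sup|v| / s + sup_{B(x,s)} |ω| + s · sup_{B(x,s)} |∇ω|)` for EVERY `s > 0` — proof sketch: localise
  `w = φ v` (cutoff `φ ≡ 1` on `B(x,s/2)`, supported in `B(x,s)`), Helmholtz-represent `w = curl(−Δ)⁻¹ curl w − ∇(−Δ)⁻¹ div w`
  exactly (compact support), bound the `∇φ`-terms (annulus, smooth kernels `~ s⁻³`) by `C sup|v| / s`, and the principal term
  `sym ∇ curl (−Δ)⁻¹ (φ ω)` by `C (s sup|∇(φω)|)` using the zero spherical means of the Calderón–Zygmund kernel (the local algebraic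
  term `−⅓ ε_{ijl} ω_l` is antisymmetric, so it does not enter the strain).  Consistency checks: scaling `v ↦ v(λ·)` with `s ↦ s/λ` ✓;
  Beltrami `(sin z, cos z, 0)` ✓; bounded irrotational ⇒ `S ≡ 0` (Liouville) ✓.
* `EfficientCellHasStrongVorticity` (G1): a cell `Q` that is `κ`-efficient at GLOBAL height `Mv` with Taylor scale `≤ L₁`
  satisfies `κ · Mv ≤ C · L₁ · (Mv / s + A + s B)` where `A, B` bound `|ω|, |∇ω|` on the `s`-neighbourhood of `Q` — so with
  `s = 2 C L₁ / κ` the neighbourhood contains vorticity data of size `≳ κ² Mv / (C² L₁ (1 + L₁/κ))`: the selected member is a GENUINE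
  strong structure, and under the uniform `C³` bounds of the zoom class its own budget on `Q_{s+1}` is bounded below (budget
  retention), hence the `C^∞_loc` limit has positive restricted budget (non-trivial profile).  PROVED here from G0 (pure algebra of
  integrals).
No summit, crux or stub is proved by this file; 26567, (L), NS regularity OPEN.
-/

namespace Summit.NavierStokesRegularity.NavierStokesRegularity.Cruxes.NearExtremalTransiencePerFlow.MemberSelection.Guard

open scoped InnerProductSpace RealInnerProductSpace
open MeasureTheory Set Metric
open Literature.Analysis.FluidPDE

/-- G0 — POINTWISE STRAIN SPLIT (analytic input, to be proved by the T1 prover): the strain quadratic form of a bounded `C³`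
divergence-free field at `x` is controlled, for every radius `s > 0`, by `sup|v| / s` (far vorticity, via the velocity) plus
`sup_{B(x,s)} |ω| + s · sup_{B(x,s)} |∇ω|` (near vorticity). -/
def StrainSplitBound : Prop :=
  ∃ C : ℝ, 0 < C ∧ ∀ (v : EuclideanSpace ℝ (Fin 3) → EuclideanSpace ℝ (Fin 3)) (Mv : ℝ),
    ContDiff ℝ 3 v → Literature.Analysis.FluidPDE.VectorCalculus.IsDivFree v → (∀ x, ‖v x‖ ≤ Mv) →
    ∀ (x : EuclideanSpace ℝ (Fin 3)) (s A B : ℝ), 0 < s →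
      (∀ y ∈ Metric.ball x s, ‖curl v y‖ ≤ A) → (∀ y ∈ Metric.ball x s, ‖fderiv ℝ (curl v) y‖ ≤ B) →
      ∀ ξ : EuclideanSpace ℝ (Fin 3), |⟪ξ, fderiv ℝ v x ξ⟫_ℝ| ≤ C * (Mv / s + A + s * B) * ‖ξ‖ ^ 2

/-- G1 — AN EFFICIENT CELL CONTAINS STRONG VORTICITY (budget-retention guard): if a measurable cell `Q` is `κ`-efficient at the
GLOBAL height `Mv` (`κ · Mv · √Z_Q · √P_Q ≤ |J_Q|`), has Taylor scale `≤ L₁` (`Z_Q ≤ L₁² P_Q`) and non-zero budgets, then for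
every `s > 0` the bounds `A ≥ |ω|`, `B ≥ |∇ω|` on the `s`-neighbourhood of `Q` satisfy `κ · Mv ≤ C · L₁ · (Mv / s + A + s B)`. -/
def EfficientCellHasStrongVorticity : Prop :=
  ∃ C : ℝ, 0 < C ∧ ∀ (v : EuclideanSpace ℝ (Fin 3) → EuclideanSpace ℝ (Fin 3)) (Mv : ℝ),
    ContDiff ℝ 3 v → Literature.Analysis.FluidPDE.VectorCalculus.IsDivFree v → (∀ x, ‖v x‖ ≤ Mv) →
    ∀ (Q : Set (EuclideanSpace ℝ (Fin 3))) (κ L₁ s A B : ℝ), MeasurableSet Q → 0 < L₁ → 0 < s →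
      (∀ x ∈ Q, ∀ y ∈ Metric.ball x s, ‖curl v y‖ ≤ A) → (∀ x ∈ Q, ∀ y ∈ Metric.ball x s, ‖fderiv ℝ (curl v) y‖ ≤ B) →
      IntegrableOn (fun x => ‖curl v x‖ ^ 2) Q →
      IntegrableOn (fun x => ⟪curl v x, fderiv ℝ v x (curl v x)⟫_ℝ) Q →
      0 < ∫ x in Q, ‖curl v x‖ ^ 2 → 0 < ∫ x in Q, frobeniusNormSq (fderiv ℝ (curl v) x) →
      (∫ x in Q, ‖curl v x‖ ^ 2) ≤ L₁ ^ 2 * ∫ x in Q, frobeniusNormSq (fderiv ℝ (curl v) x) →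
      κ * Mv * Real.sqrt (∫ x in Q, ‖curl v x‖ ^ 2) * Real.sqrt (∫ x in Q, frobeniusNormSq (fderiv ℝ (curl v) x)) ≤
        |∫ x in Q, ⟪curl v x, fderiv ℝ v x (curl v x)⟫_ℝ| →
      κ * Mv ≤ C * L₁ * (Mv / s + A + s * B)

/-- G1 from G0: pure algebra of integrals (the guard's analytic content is entirely in `StrainSplitBound`). -/
theorem efficientCellHasStrongVorticity_of_strainSplitBound (h : StrainSplitBound) : EfficientCellHasStrongVorticity := by
  obtain ⟨C, hC, hSS⟩ := h
  refine ⟨C, hC, ?_⟩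
  intro v Mv hv hdiv hM Q κ L₁ s A B hQ hL hs hA hB hZi hJi hZpos hPpos hTaylor heff
  set Z : ℝ := ∫ x in Q, ‖curl v x‖ ^ 2 with hZdef
  set P : ℝ := ∫ x in Q, frobeniusNormSq (fderiv ℝ (curl v) x) with hPdef
  set K : ℝ := C * (Mv / s + A + s * B) with hKdef
  -- pointwise strain bound on the cell
  have hpt : ∀ x ∈ Q, |⟪curl v x, fderiv ℝ v x (curl v x)⟫_ℝ| ≤ K * ‖curl v x‖ ^ 2 := by
    intro x hx
    exact hSS v Mv hv hdiv hM x s A B hs (hA x hx) (hB x hx) (curl v x)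
  -- integrate
  have hJ : |∫ x in Q, ⟪curl v x, fderiv ℝ v x (curl v x)⟫_ℝ| ≤ K * Z := by
    calc |∫ x in Q, ⟪curl v x, fderiv ℝ v x (curl v x)⟫_ℝ|
        ≤ ∫ x in Q, |⟪curl v x, fderiv ℝ v x (curl v x)⟫_ℝ| := abs_integral_le_integral_abs
      _ ≤ ∫ x in Q, K * ‖curl v x‖ ^ 2 := by
          exact setIntegral_mono_on hJi.abs (hZi.const_mul K) hQ hpt
      _ = K * Z := by rw [hZdef]; exact integral_const_mul K _
  -- K ≥ 0 (forced by 0 ≤ |J| ≤ K Z with Z > 0)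
  have hK : 0 ≤ K := by
    by_contra hneg
    push Not at hneg
    have : K * Z < 0 := mul_neg_of_neg_of_pos hneg hZpos
    linarith [abs_nonneg (∫ x in Q, ⟪curl v x, fderiv ℝ v x (curl v x)⟫_ℝ)]
  -- Taylor scale: Z ≤ L₁ √Z √P
  have hsqZ : 0 < Real.sqrt Z := Real.sqrt_pos.mpr hZpos
  have hsqP : 0 < Real.sqrt P := Real.sqrt_pos.mpr hPpos
  have hZle : Z ≤ L₁ * Real.sqrt Z * Real.sqrt P := by
    have h1 : Real.sqrt Z ≤ L₁ * Real.sqrt P := by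
      calc Real.sqrt Z ≤ Real.sqrt (L₁ ^ 2 * P) := Real.sqrt_le_sqrt hTaylor
        _ = L₁ * Real.sqrt P := by
            rw [Real.sqrt_mul (sq_nonneg L₁), Real.sqrt_sq hL.le]
    calc Z = Real.sqrt Z * Real.sqrt Z := (Real.mul_self_sqrt hZpos.le).symm
      _ ≤ (L₁ * Real.sqrt P) * Real.sqrt Z := by
          exact mul_le_mul_of_nonneg_right h1 hsqZ.le
      _ = L₁ * Real.sqrt Z * Real.sqrt P := by ring
  -- chain and cancel √Z √P > 0
  have hprod : 0 < Real.sqrt Z * Real.sqrt P := mul_pos hsqZ hsqP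
  have key : κ * Mv * (Real.sqrt Z * Real.sqrt P) ≤ C * L₁ * (Mv / s + A + s * B) * (Real.sqrt Z * Real.sqrt P) := by
    have h2 : K * Z ≤ K * (L₁ * Real.sqrt Z * Real.sqrt P) := mul_le_mul_of_nonneg_left hZle hK
    calc κ * Mv * (Real.sqrt Z * Real.sqrt P) = κ * Mv * Real.sqrt Z * Real.sqrt P := by ring
      _ ≤ |∫ x in Q, ⟪curl v x, fderiv ℝ v x (curl v x)⟫_ℝ| := heff
      _ ≤ K * Z := hJ
      _ ≤ K * (L₁ * Real.sqrt Z * Real.sqrt P) := h2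
      _ = C * L₁ * (Mv / s + A + s * B) * (Real.sqrt Z * Real.sqrt P) := by rw [hKdef]; ring
  exact le_of_mul_le_mul_right key hprod

end Summit.NavierStokesRegularity.NavierStokesRegularity.Cruxes.NearExtremalTransiencePerFlow.MemberSelection.Guard
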